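import Literature.NumberTheory.PAdicHodge.BdRPlusLogTypeSeries
import Mathlib.RingTheory.MvPowerSeries.Trunc
import HarnessLib

/-!
# Additivity of logarithmic-type series along a formal group law, `p`-adically modulo `Fil^k B_dR⁺`

Topic `Literature/NumberTheory/PAdicHodge`; namespaces `…PAdicHodge.LogTypeSeries` (§1, pure algebra) and `…PAdicHodge.GaloisContinuity` (§2–§3).
THEOREMS ONLY (no definition, no instance, no named fact, no `sorry`). Sequel of `BdRPlusLogTypeSeries` (`IsLogTypeModFil b k y L`: `L` is a value
modulo `Fil^k` of `ℓ_b(y) = Σ (b_m/m) ι(y)^m`, `y ∈ (p, ξ)𝔸_inf`) and the abstract version of `BdRPlusLogLatticeMul` (the case `ℓ = log`,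
`G = X₀ + X₁ + X₀X₁`). DATA: a series `f ∈ ℚ⟦X⟧` with the numerators `b` (`b_n/n = coeff_n f` in `ℚ_p`), and an INTEGRAL two-variable series
`G ∈ ℤ⟦X₀, X₁⟧` without constant term satisfying the functional equation `f(G(X₀, X₁)) = f(X₀) + f(X₁)` — e.g. `f = log_W` (`WeierstrassCurve.formalLog`),
`G = F_W` (`WeierstrassCurve.formalGroupLaw` of an integral model; tree `formalLog_subst_formalGroupLaw`, AEC IV.5.2).

* §1 TRUNCATION (any commutative `ℚ`-algebra): with `G_D = truncTotal_{D+1} G` and `P_M(q) = Σ_{m<M} c_{m+1} q^{m+1}` (`c = coeff f`): for `M ≤ D`,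
  `P_M(G_D(z)) − P_M(z₀) − P_M(z₁) = Σ_{m<M} c_{m+1} · H_{m+1}(z)` with INTEGER polynomials `H_n = G_Dⁿ − truncTotal_{M+1}(G_Dⁿ)` supported in
  total degrees `≥ M + 1` (★ `aeval_sum_truncTotal_sub`; Mathlib `MvPowerSeries.coeff_truncTotal_pow`).
* §2 ESTIMATE: `P^b_M(G_D(y, y')) − P^b_M(y) − P^b_M(y') ∈ Λ(j, k)` for `y, y' ∈ (p,ξ)`, `2(j+k) ≤ M ≤ D`
  (★ `logTypePartialSum_aeval_truncTotal_sub_mem_lattice`).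
* §3 ★★ `IsLogTypeModFil.add_of_forall_sub_aeval_truncTotal_mem`: if `g ∈ 𝔸_inf` is a `(p,ξ)`-adic value of `G` at `(y, y')`
  (`g − G_D(y,y') ∈ (p,ξ)^{D+1}` for all `D`; e.g. the tree's `LubinTate.evalPt`), `L`, `L'` are values of `ℓ_b(y)`, `ℓ_b(y')` modulo `Fil^k`, then
  `L + L'` is a value of `ℓ_b(g)`: **`ℓ_b(G(y, y')) ≡ ℓ_b(y) + ℓ_b(y') (mod Fil^k)`** — Fontaine's `p`-adic evaluation of a formal-group logarithm on
  `Ĝ((p, ξ)𝔸_inf)` is a homomorphism.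

Use: the `p`-adic evaluation layer of Fontaine's integrating element `log_W(ι[ũ])` (tree `AinfWeierstrassKummerIntegral`) — floor (H4) step (3) of
`Summits/…/Cruxes/StarredOptimalManinUnitFiveSeven/Lines/kato-lever-K3-B2-road.md` / memo `…-K3-H4-log.md` §3b (crux K★ `stmt-BirchSwinnertonDyer-22226`).
Infrastructure only; BSD / K★ are not proved by any of this.

## References
* J. H. Silverman, *The Arithmetic of Elliptic Curves* (2009), IV.5.2 (`log_F(F(X,Y)) = log_F X + log_F Y`). [SilvermanAEC2009]
* J.-M. Fontaine, *Formes différentielles et modules de Tate…*, Invent. Math. 65 (1982), §5. [Fontaine1982FormesDifferentielles]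
* J.-M. Fontaine, *Le corps des périodes p-adiques*, Astérisque 223 (1994), Exp. II §1.5.3–1.5.4. [FontaineAsterisque223III]
-/

noncomputable section

open MvPowerSeries (truncTotal)

namespace Literature.NumberTheory.PAdicHodge

/-! ## §1 Truncating `f(G(X₀, X₁)) = f(X₀) + f(X₁)` at total degree `M`, for a power series `G` -/
namespace LogTypeSeries

open Finset MvPolynomial

/-- For `a ∈ ℚ⟦X₀,X₁⟧` without constant term and `|d| ≤ M`, `coeff_d(f(a)) = Σ_{n ≤ M} coeff_n(f) · coeff_d(aⁿ)`.
[cite: SilvermanAEC2009, IV.2] -/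
theorem coeff_subst_eq_sum (f : PowerSeries ℚ) {a : MvPowerSeries (Fin 2) ℚ} (ha : MvPowerSeries.constantCoeff a = 0)
    {d : Fin 2 →₀ ℕ} {M : ℕ} (hd : d.degree ≤ M) :
    MvPowerSeries.coeff d (f.subst a) = ∑ n ∈ range (M + 1), PowerSeries.coeff n f * MvPowerSeries.coeff d (a ^ n) := by
  have hs : PowerSeries.HasSubst a := PowerSeries.HasSubst.of_constantCoeff_zero ha
  rw [PowerSeries.coeff_subst hs]
  refine (finsum_eq_sum_of_support_subset _ ?_).trans (Finset.sum_congr rfl fun n _ => smul_eq_mul _ _)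
  intro n hn
  rw [Finset.mem_coe, Finset.mem_range]
  by_contra h
  have hlt : (d.degree : ℕ∞) < (a ^ n).order := lt_of_lt_of_le (by exact_mod_cast (show d.degree < n by omega))
    (MvPowerSeries.le_order_pow_of_constantCoeff_eq_zero n ha)
  exact hn (by simp only [MvPowerSeries.coeff_of_lt_order hlt, smul_zero])

/-- ★ **The truncated functional equation, coefficientwise, for a power series `G`.** If `f(G) = f(X₀) + f(X₁)` with `G(0) = 0`, then for
`|d| ≤ M ≤ D` and `G_D = truncTotal_{D+1} G`: `Σ_{n≤M} c_n coeff_d(G_Dⁿ) = Σ_{n≤M} c_n (coeff_d X₀ⁿ + coeff_d X₁ⁿ)`. [cite: SilvermanAEC2009, IV.5.2] -/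
theorem sum_coeff_mul_coeff_truncTotal_pow (f : PowerSeries ℚ) {G : MvPowerSeries (Fin 2) ℚ} (hG0 : MvPowerSeries.constantCoeff G = 0)
    (hfG : f.subst G = f.subst (MvPowerSeries.X 0 : MvPowerSeries (Fin 2) ℚ) + f.subst (MvPowerSeries.X 1 : MvPowerSeries (Fin 2) ℚ))
    {d : Fin 2 →₀ ℕ} {M D : ℕ} (hd : d.degree ≤ M) (hMD : M ≤ D) :
    ∑ n ∈ range (M + 1), PowerSeries.coeff n f * MvPolynomial.coeff d (truncTotal (D + 1) G ^ n) =
      ∑ n ∈ range (M + 1), PowerSeries.coeff n f *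
        (MvPolynomial.coeff d ((X 0 : MvPolynomial (Fin 2) ℚ) ^ n) + MvPolynomial.coeff d ((X 1 : MvPolynomial (Fin 2) ℚ) ^ n)) := by
  have key := congrArg (MvPowerSeries.coeff d) hfG
  rw [map_add, coeff_subst_eq_sum f hG0 hd, coeff_subst_eq_sum f (MvPowerSeries.constantCoeff_X 0) hd,
    coeff_subst_eq_sum f (MvPowerSeries.constantCoeff_X 1) hd, ← Finset.sum_add_distrib] at key
  have e1 : ∀ n : ℕ, MvPolynomial.coeff d (truncTotal (D + 1) G ^ n) = MvPowerSeries.coeff d (G ^ n) := fun n =>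
    MvPowerSeries.coeff_truncTotal_pow G (by omega)
  have e2 : ∀ (i : Fin 2) (n : ℕ), MvPolynomial.coeff d ((X i : MvPolynomial (Fin 2) ℚ) ^ n) =
      MvPowerSeries.coeff d ((MvPowerSeries.X i : MvPowerSeries (Fin 2) ℚ) ^ n) := fun i n => by
    rw [← MvPolynomial.coeff_coe, MvPolynomial.coe_pow, MvPolynomial.coe_X]
  simp only [e1, e2, key]
  exact Finset.sum_congr rfl fun n _ => by ring

/-- ★ **The truncated functional equation as a polynomial identity**: `Σ_{m<M} c_{m+1} · truncTotal_{M+1}(G_D^{m+1}) = P_M(X₀) + P_M(X₁)`,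
`P_M(q) = Σ_{m<M} c_{m+1} q^{m+1}`, for `M ≤ D`. [cite: SilvermanAEC2009, IV.5.2] -/
theorem sum_C_mul_truncTotal_pow (f : PowerSeries ℚ) {G : MvPowerSeries (Fin 2) ℚ} (hG0 : MvPowerSeries.constantCoeff G = 0)
    (hfG : f.subst G = f.subst (MvPowerSeries.X 0 : MvPowerSeries (Fin 2) ℚ) + f.subst (MvPowerSeries.X 1 : MvPowerSeries (Fin 2) ℚ))
    {M D : ℕ} (hMD : M ≤ D) :
    ∑ m ∈ range M, MvPolynomial.C (PowerSeries.coeff (m + 1) f) *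
        truncTotal (M + 1) ((truncTotal (D + 1) G ^ (m + 1) : MvPolynomial (Fin 2) ℚ) : MvPowerSeries (Fin 2) ℚ) =
      ∑ m ∈ range M, MvPolynomial.C (PowerSeries.coeff (m + 1) f) * (X 0 : MvPolynomial (Fin 2) ℚ) ^ (m + 1) +
        ∑ m ∈ range M, MvPolynomial.C (PowerSeries.coeff (m + 1) f) * (X 1 : MvPolynomial (Fin 2) ℚ) ^ (m + 1) := by
  classical
  refine MvPolynomial.ext _ _ fun d => ?_
  rw [MvPolynomial.coeff_add, MvPolynomial.coeff_sum, MvPolynomial.coeff_sum, MvPolynomial.coeff_sum]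
  simp only [MvPolynomial.coeff_C_mul]
  by_cases hd : d.degree ≤ M
  · have hd' : d.degree < M + 1 := Nat.lt_succ_of_le hd
    simp only [MvPowerSeries.coeff_truncTotal _ hd', MvPolynomial.coeff_coe]
    have key := sum_coeff_mul_coeff_truncTotal_pow f hG0 hfG hd hMD
    rw [Finset.sum_range_succ', Finset.sum_range_succ'] at key
    simp only [pow_zero, MvPolynomial.coeff_one] at key
    rw [← Finset.sum_add_distrib]
    have key' : ∑ m ∈ range M, PowerSeries.coeff (m + 1) f * MvPolynomial.coeff d (truncTotal (D + 1) G ^ (m + 1)) =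
        ∑ m ∈ range M, PowerSeries.coeff (m + 1) f *
          (MvPolynomial.coeff d ((X 0 : MvPolynomial (Fin 2) ℚ) ^ (m + 1)) + MvPolynomial.coeff d ((X 1 : MvPolynomial (Fin 2) ℚ) ^ (m + 1))) := by
      by_cases hd0 : 0 = d
      · -- `d = 0`: every positive power has zero constant coefficient on both sides
        subst hd0
        refine Finset.sum_congr rfl fun m _ => ?_
        have hz : ∀ q : MvPolynomial (Fin 2) ℚ, MvPolynomial.constantCoeff q = 0 → MvPolynomial.coeff 0 (q ^ (m + 1)) = 0 := fun q hq => by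
          rw [← MvPolynomial.constantCoeff_eq, map_pow, hq, zero_pow (Nat.succ_ne_zero m)]
        rw [hz _ (by rw [MvPolynomial.constantCoeff_eq, MvPowerSeries.coeff_truncTotal _ (by simp), MvPowerSeries.coeff_zero_eq_constantCoeff,
          hG0]), hz _ (MvPolynomial.constantCoeff_X ℚ 0), hz _ (MvPolynomial.constantCoeff_X ℚ 1), add_zero]
      · simpa only [if_neg hd0, mul_zero, add_zero] using key
    rw [key']
    exact Finset.sum_congr rfl fun m _ => by ring
  · have hd' : M + 1 ≤ d.degree := by omega
    have hX : ∀ (i : Fin 2), ∀ m ∈ range M, PowerSeries.coeff (m + 1) f *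
        MvPolynomial.coeff d ((X i : MvPolynomial (Fin 2) ℚ) ^ (m + 1)) = 0 := by
      intro i m hm
      rw [MvPolynomial.coeff_X_pow, if_neg, mul_zero]
      rintro rfl
      rw [Finsupp.degree_single] at hd'
      exact absurd (Finset.mem_range.1 hm) (by omega)
    rw [Finset.sum_eq_zero (hX 0), Finset.sum_eq_zero (hX 1), add_zero]
    exact Finset.sum_eq_zero fun m _ => by rw [MvPowerSeries.coeff_truncTotal_eq_zero _ hd', mul_zero]

/-- `H = qⁿ − truncTotal_{M+1}(qⁿ)` has no monomial of total degree `≤ M`. [cite: SilvermanAEC2009, IV.2] -/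
private theorem coeff_pow_sub_truncTotal_eq_zero' {R : Type*} [CommRing R] (q : MvPolynomial (Fin 2) R) (n : ℕ) {M : ℕ}
    {d : Fin 2 →₀ ℕ} (hd : d.degree < M + 1) :
    MvPolynomial.coeff d (q ^ n - truncTotal (M + 1) ((q ^ n : MvPolynomial (Fin 2) R) : MvPowerSeries (Fin 2) R)) = 0 := by
  rw [MvPolynomial.coeff_sub, MvPowerSeries.coeff_truncTotal _ hd, MvPolynomial.coeff_coe, sub_self]

/-- Base change `ℤ → ℚ` of `G_D = truncTotal_{D+1} G`. [cite: SilvermanAEC2009, IV.2] -/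
private theorem map_truncTotal (G : MvPowerSeries (Fin 2) ℤ) (D : ℕ) :
    MvPolynomial.map (Int.castRingHom ℚ) (truncTotal (D + 1) G) = truncTotal (D + 1) (MvPowerSeries.map (Int.castRingHom ℚ) G) :=
  (MvPowerSeries.truncFinset_map _ _).symm

/-- Base change `ℤ → ℚ` of the integer polynomials `H_n = G_Dⁿ − truncTotal_{M+1}(G_Dⁿ)`. [cite: SilvermanAEC2009, IV.2] -/
private theorem map_pow_sub_truncTotal (G : MvPowerSeries (Fin 2) ℤ) (M D n : ℕ) :
    MvPolynomial.map (Int.castRingHom ℚ) (truncTotal (D + 1) G ^ n -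
        truncTotal (M + 1) ((truncTotal (D + 1) G ^ n : MvPolynomial (Fin 2) ℤ) : MvPowerSeries (Fin 2) ℤ)) =
      truncTotal (D + 1) (MvPowerSeries.map (Int.castRingHom ℚ) G) ^ n -
        truncTotal (M + 1) ((truncTotal (D + 1) (MvPowerSeries.map (Int.castRingHom ℚ) G) ^ n : MvPolynomial (Fin 2) ℚ) :
          MvPowerSeries (Fin 2) ℚ) := by
  have hG : MvPolynomial.map (Int.castRingHom ℚ) (truncTotal (D + 1) G ^ n) = truncTotal (D + 1) (MvPowerSeries.map (Int.castRingHom ℚ) G) ^ n := by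
    rw [map_pow, map_truncTotal]
  refine MvPolynomial.ext _ _ fun d => ?_
  rw [MvPolynomial.coeff_map, MvPolynomial.coeff_sub, MvPolynomial.coeff_sub, map_sub, ← MvPolynomial.coeff_map, hG,
    MvPowerSeries.coeff_truncTotal_eq_ite, MvPowerSeries.coeff_truncTotal_eq_ite, MvPolynomial.coeff_coe, MvPolynomial.coeff_coe]
  split_ifs with h
  exacts [by rw [← MvPolynomial.coeff_map, hG], by rw [map_zero]]

/-- ★ **The truncated functional equation with its error term** (commutative `ℚ`-algebra `B`, `z : Fin 2 → B`, `c = coeff f`, `G ∈ ℤ⟦X₀,X₁⟧` with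
`G(0) = 0` and `f(G) = f(X₀) + f(X₁)` after base change, `M ≤ D`, `G_D = truncTotal_{D+1} G`):
`Σ_{m<M} c_{m+1} G_D(z)^{m+1} − Σ_{m<M} c_{m+1} z₀^{m+1} − Σ_{m<M} c_{m+1} z₁^{m+1} = Σ_{m<M} c_{m+1} · H_{m+1}(z)`,
`H_n = G_Dⁿ − truncTotal_{M+1}(G_Dⁿ) ∈ ℤ[X₀,X₁]` supported in degrees `≥ M + 1`. [cite: SilvermanAEC2009, IV.5.2] -/
theorem aeval_sum_truncTotal_sub {B : Type*} [CommRing B] [Algebra ℚ B] (f : PowerSeries ℚ) {G : MvPowerSeries (Fin 2) ℤ}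
    (hG0 : MvPowerSeries.constantCoeff G = 0)
    (hfG : f.subst (MvPowerSeries.map (Int.castRingHom ℚ) G) =
      f.subst (MvPowerSeries.X 0 : MvPowerSeries (Fin 2) ℚ) + f.subst (MvPowerSeries.X 1 : MvPowerSeries (Fin 2) ℚ))
    {M D : ℕ} (hMD : M ≤ D) (z : Fin 2 → B) :
    ∑ m ∈ range M, algebraMap ℚ B (PowerSeries.coeff (m + 1) f) * MvPolynomial.aeval z (truncTotal (D + 1) G) ^ (m + 1) -
        ∑ m ∈ range M, algebraMap ℚ B (PowerSeries.coeff (m + 1) f) * z 0 ^ (m + 1) -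
        ∑ m ∈ range M, algebraMap ℚ B (PowerSeries.coeff (m + 1) f) * z 1 ^ (m + 1) =
      ∑ m ∈ range M, algebraMap ℚ B (PowerSeries.coeff (m + 1) f) *
        MvPolynomial.aeval z (truncTotal (D + 1) G ^ (m + 1) -
          truncTotal (M + 1) ((truncTotal (D + 1) G ^ (m + 1) : MvPolynomial (Fin 2) ℤ) : MvPowerSeries (Fin 2) ℤ)) := by
  set Gq : MvPowerSeries (Fin 2) ℚ := MvPowerSeries.map (Int.castRingHom ℚ) G with hGq
  have hGq0 : MvPowerSeries.constantCoeff Gq = 0 := by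
    rw [hGq, ← MvPowerSeries.coeff_zero_eq_constantCoeff, MvPowerSeries.coeff_map, MvPowerSeries.coeff_zero_eq_constantCoeff, hG0, map_zero]
  -- universal case in `ℚ[X₀, X₁]`
  have univ : ∑ m ∈ range M, MvPolynomial.C (PowerSeries.coeff (m + 1) f) * (truncTotal (D + 1) Gq) ^ (m + 1) -
      ∑ m ∈ range M, MvPolynomial.C (PowerSeries.coeff (m + 1) f) * (X 0 : MvPolynomial (Fin 2) ℚ) ^ (m + 1) -
      ∑ m ∈ range M, MvPolynomial.C (PowerSeries.coeff (m + 1) f) * (X 1 : MvPolynomial (Fin 2) ℚ) ^ (m + 1) =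
      ∑ m ∈ range M, MvPolynomial.C (PowerSeries.coeff (m + 1) f) *
        ((truncTotal (D + 1) Gq) ^ (m + 1) - truncTotal (M + 1) (((truncTotal (D + 1) Gq) ^ (m + 1) : MvPolynomial (Fin 2) ℚ) :
          MvPowerSeries (Fin 2) ℚ)) := by
    rw [sub_sub, ← sum_C_mul_truncTotal_pow f hGq0 hfG hMD, ← Finset.sum_sub_distrib]
    exact Finset.sum_congr rfl fun m _ => by rw [mul_sub]
  -- specialise along `aeval z`
  have h := congrArg (MvPolynomial.aeval z) univ
  simp only [map_sub, map_sum, map_mul, map_pow, MvPolynomial.aeval_C, MvPolynomial.aeval_X] at h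
  have hGD : MvPolynomial.aeval z (truncTotal (D + 1) Gq) = MvPolynomial.aeval z (truncTotal (D + 1) G) := by
    rw [hGq, ← map_truncTotal, ← algebraMap_int_eq, MvPolynomial.aeval_map_algebraMap]
  have hH : ∀ n : ℕ, MvPolynomial.aeval z (truncTotal (D + 1) Gq ^ n) -
      MvPolynomial.aeval z (truncTotal (M + 1) ((truncTotal (D + 1) Gq ^ n : MvPolynomial (Fin 2) ℚ) : MvPowerSeries (Fin 2) ℚ)) =
      MvPolynomial.aeval z (truncTotal (D + 1) G ^ n -
        truncTotal (M + 1) ((truncTotal (D + 1) G ^ n : MvPolynomial (Fin 2) ℤ) : MvPowerSeries (Fin 2) ℤ)) := fun n => by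
    rw [← map_sub, hGq, ← map_pow_sub_truncTotal G M D n, ← algebraMap_int_eq, MvPolynomial.aeval_map_algebraMap]
  rw [hGD] at h
  rw [h]
  exact Finset.sum_congr rfl fun m _ => by rw [← hGD, ← map_pow, hH]

/-- An integer polynomial supported in total degrees `≥ N` evaluates into `I^N` on an ideal `I`. [folklore] -/
private theorem aeval_mem_pow_of_coeff_eq_zero' {σ R : Type*} [CommRing R] {I : Ideal R} {y : σ → R} (hy : ∀ i, y i ∈ I)
    {q : MvPolynomial σ ℤ} {N : ℕ} (hq : ∀ d : σ →₀ ℕ, d.degree < N → MvPolynomial.coeff d q = 0) :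
    MvPolynomial.aeval y q ∈ I ^ N := by
  rw [MvPolynomial.as_sum q, map_sum]
  refine Ideal.sum_mem _ fun d hd => ?_
  have hN : N ≤ d.degree := not_lt.1 fun h => (MvPolynomial.mem_support_iff.1 hd) (hq d h)
  rw [MvPolynomial.aeval_monomial]
  refine Ideal.mul_mem_left _ _ (Ideal.pow_le_pow_right hN ?_)
  rw [Finsupp.prod, Finsupp.degree_apply, ← Finset.prod_pow_eq_pow_sum]
  exact Ideal.prod_mem_prod fun i _ => Ideal.pow_mem_pow (hy i) _

/-- `G_D(y, y') ∈ I` for `y, y' ∈ I` (`G` has no constant term). [cite: SilvermanAEC2009, IV.2] -/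
theorem aeval_truncTotal_mem {R : Type*} [CommRing R] {I : Ideal R} {y : Fin 2 → R} (hy : ∀ i, y i ∈ I)
    {G : MvPowerSeries (Fin 2) ℤ} (hG0 : MvPowerSeries.constantCoeff G = 0) (D : ℕ) :
    MvPolynomial.aeval y (truncTotal (D + 1) G) ∈ I := by
  have h := aeval_mem_pow_of_coeff_eq_zero' hy (q := truncTotal (D + 1) G) (N := 1) fun d hd => by
    have hd0 : d = 0 := (Finsupp.degree_eq_zero_iff d).1 (by omega)
    subst hd0
    rw [MvPowerSeries.coeff_truncTotal _ (by simp), MvPowerSeries.coeff_zero_eq_constantCoeff, hG0]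
  rwa [pow_one] at h

/-- `H_n(y, y') ∈ I^{M+1}` (the error polynomials of the truncated functional equation are small on an ideal). [cite: SilvermanAEC2009, IV.2] -/
theorem aeval_pow_sub_truncTotal_mem_pow {R : Type*} [CommRing R] {I : Ideal R} {y : Fin 2 → R} (hy : ∀ i, y i ∈ I)
    (G : MvPowerSeries (Fin 2) ℤ) (M D n : ℕ) :
    MvPolynomial.aeval y (truncTotal (D + 1) G ^ n -
        truncTotal (M + 1) ((truncTotal (D + 1) G ^ n : MvPolynomial (Fin 2) ℤ) : MvPowerSeries (Fin 2) ℤ)) ∈ I ^ (M + 1) :=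
  aeval_mem_pow_of_coeff_eq_zero' hy fun _ hd => coeff_pow_sub_truncTotal_eq_zero' _ _ hd

end LogTypeSeries

/-! ## §2 The lattice estimate and §3 additivity modulo `Fil^k` -/
namespace GaloisContinuity

open ValuativeRel Field Ideal WittVector Finset
open Literature.NumberTheory.GaloisRepresentations Literature.NumberTheory.GaloisRepresentations.IsNonarchimedeanLocalField

variable {F : Type} [Field F] [ValuativeRel F] [TopologicalSpace F] [IsNonarchimedeanLocalField F]
  [CharZero F] {p : ℕ} [Fact p.Prime] [Fact (¬ IsUnit (p : integerC F))]
  [IsAdicComplete (Ideal.span {(p : integerC F)}) (integerC F)]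

omit [CharZero F] in
/-- `P^b_M(y) = Σ_{m<M} c_{m+1} ι(y)^{m+1}` when `b_n/n = c_n` (`c = coeff f`). [cite: Fontaine1982FormesDifferentielles, §5] -/
theorem logTypePartialSum_eq_sum_algebraMap {b : ℕ → ℤ_[p]} {f : PowerSeries ℚ}
    (hb : ∀ n : ℕ, ((b n : ℤ_[p]) : ℚ_[p]) / (n : ℚ_[p]) = algebraMap ℚ ℚ_[p] (PowerSeries.coeff n f)) (y : Ainf (p := p) F) (M : ℕ) :
    logTypePartialSum b y M = ∑ m ∈ range M, algebraMap ℚ (BDeRhamPlus (integerC F) p) (PowerSeries.coeff (m + 1) f) * ainfToBdR y ^ (m + 1) := by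
  refine Finset.sum_congr rfl fun m _ => ?_
  rw [logTypeTerm, algebraMap_rat_bDeRhamPlus, ← hb, Nat.cast_add, Nat.cast_one]

/-- `y, y' ∈ I` as a `Fin 2`-family. [folklore] -/
private theorem vecCons_mem' {R : Type*} [CommRing R] {I : Ideal R} {y y' : R} (hy : y ∈ I) (hy' : y' ∈ I) :
    ∀ i : Fin 2, (![y, y'] : Fin 2 → R) i ∈ I := by
  intro i; fin_cases i; exacts [hy, hy']

omit [CharZero F] in
/-- ★ **The defect of the partial sums at a truncation of `G` is small**: for `y, y' ∈ (p, ξ)`, `2(j+k) ≤ M ≤ D`,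
`P^b_M(G_D(y, y')) − P^b_M(y) − P^b_M(y') ∈ Λ(j, k)`. [cite: FontaineAsterisque223III, Exp. II §1.5.3] [cite: SilvermanAEC2009, IV.5.2] -/
theorem logTypePartialSum_aeval_truncTotal_sub_mem_lattice {b : ℕ → ℤ_[p]} {f : PowerSeries ℚ}
    (hb : ∀ n : ℕ, ((b n : ℤ_[p]) : ℚ_[p]) / (n : ℚ_[p]) = algebraMap ℚ ℚ_[p] (PowerSeries.coeff n f))
    {G : MvPowerSeries (Fin 2) ℤ} (hG0 : MvPowerSeries.constantCoeff G = 0)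
    (hfG : f.subst (MvPowerSeries.map (Int.castRingHom ℚ) G) =
      f.subst (MvPowerSeries.X 0 : MvPowerSeries (Fin 2) ℚ) + f.subst (MvPowerSeries.X 1 : MvPowerSeries (Fin 2) ℚ))
    {y y' : Ainf (p := p) F} (hy : y ∈ Ideal.span {(p : Ainf (p := p) F), xi}) (hy' : y' ∈ Ideal.span {(p : Ainf (p := p) F), xi})
    {j k M D : ℕ} (hM : 2 * (j + k) ≤ M) (hMD : M ≤ D) :
    ∃ (a : Ainf (p := p) F) (w : BDeRhamPlus (integerC F) p),
      logTypePartialSum b (MvPolynomial.aeval ![y, y'] (truncTotal (D + 1) G)) M - logTypePartialSum b y M - logTypePartialSum b y' M =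
        ainfToBdR ((p : Ainf (p := p) F) ^ j * a) + xiBdR ^ k * w := by
  set z : Fin 2 → BDeRhamPlus (integerC F) p := fun i => ainfToBdR ((![y, y'] : Fin 2 → Ainf (p := p) F) i) with hz
  have h0 : z 0 = ainfToBdR y := rfl
  have h1 : z 1 = ainfToBdR y' := rfl
  have hfun : (fun i => (ainfToBdR (F := F) (p := p)).toIntAlgHom ((![y, y'] : Fin 2 → Ainf (p := p) F) i)) = z := funext fun i => rfl
  have hG : ainfToBdR (MvPolynomial.aeval ![y, y'] (truncTotal (D + 1) G)) = MvPolynomial.aeval z (truncTotal (D + 1) G) := by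
    rw [show ainfToBdR (MvPolynomial.aeval ![y, y'] (truncTotal (D + 1) G)) =
      (ainfToBdR (F := F) (p := p)).toIntAlgHom (MvPolynomial.aeval ![y, y'] (truncTotal (D + 1) G)) from rfl,
      MvPolynomial.comp_aeval_apply, hfun]
  rw [logTypePartialSum_eq_sum_algebraMap hb, logTypePartialSum_eq_sum_algebraMap hb, logTypePartialSum_eq_sum_algebraMap hb, hG, ← h0, ← h1,
    LogTypeSeries.aeval_sum_truncTotal_sub f hG0 hfG hMD z]
  refine lattice_sum _ fun m hm => ?_
  have hH := MvPolynomial.comp_aeval_apply (ainfToBdR (F := F) (p := p)).toIntAlgHom (f := (![y, y'] : Fin 2 → Ainf (p := p) F))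
    (truncTotal (D + 1) G ^ (m + 1) - truncTotal (M + 1) ((truncTotal (D + 1) G ^ (m + 1) : MvPolynomial (Fin 2) ℤ) : MvPowerSeries (Fin 2) ℤ))
  rw [hfun] at hH
  rw [← hH, RingHom.toIntAlgHom_apply, algebraMap_rat_bDeRhamPlus, ← hb, show ((m + 1 : ℕ) : ℚ_[p]) = ((m + 1 : ℕ) : ℚ_[p]) from rfl]
  exact coeff_mul_ainfToBdR_mem_lattice b hM (Finset.mem_range.1 hm)
    (LogTypeSeries.aeval_pow_sub_truncTotal_mem_pow (vecCons_mem' hy hy') G M D (m + 1))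

omit [CharZero F] in
/-- ★★ **`ℓ_b(G(y, y')) ≡ ℓ_b(y) + ℓ_b(y') (mod Fil^k)`: a formal-group logarithm is additive on `Ĝ((p, ξ)𝔸_inf)`, `p`-adically modulo `Fil^k`.**
If `G ∈ ℤ⟦X₀,X₁⟧` (no constant term) satisfies `f(G) = f(X₀) + f(X₁)`, `b_n/n = coeff_n f`, `g ∈ 𝔸_inf` is the `(p, ξ)`-adic value of `G` at
`(y, y')` (`g − G_D(y, y') ∈ (p,ξ)^{D+1}` for every `D`), and `L`, `L'` are values of `ℓ_b(y)`, `ℓ_b(y')` modulo `Fil^k`, then `L + L'` is a value of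
`ℓ_b(g)` modulo `Fil^k`. [cite: SilvermanAEC2009, IV.5.2] [cite: Fontaine1982FormesDifferentielles, §5] [cite: FontaineAsterisque223III, Exp. II §1.5.4] -/
theorem IsLogTypeModFil.add_of_forall_sub_aeval_truncTotal_mem {b : ℕ → ℤ_[p]} {f : PowerSeries ℚ}
    (hb : ∀ n : ℕ, ((b n : ℤ_[p]) : ℚ_[p]) / (n : ℚ_[p]) = algebraMap ℚ ℚ_[p] (PowerSeries.coeff n f))
    {G : MvPowerSeries (Fin 2) ℤ} (hG0 : MvPowerSeries.constantCoeff G = 0)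
    (hfG : f.subst (MvPowerSeries.map (Int.castRingHom ℚ) G) =
      f.subst (MvPowerSeries.X 0 : MvPowerSeries (Fin 2) ℚ) + f.subst (MvPowerSeries.X 1 : MvPowerSeries (Fin 2) ℚ))
    {k : ℕ} {y y' g : Ainf (p := p) F} (hy : y ∈ Ideal.span {(p : Ainf (p := p) F), xi}) (hy' : y' ∈ Ideal.span {(p : Ainf (p := p) F), xi})
    (hg : ∀ D : ℕ, g - MvPolynomial.aeval ![y, y'] (truncTotal (D + 1) G) ∈ Ideal.span {(p : Ainf (p := p) F), xi} ^ (D + 1))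
    {L L' : BDeRhamPlus (integerC F) p} (hL : IsLogTypeModFil b k y L) (hL' : IsLogTypeModFil b k y' L') :
    IsLogTypeModFil b k g (L + L') := by
  have hGD : ∀ D, MvPolynomial.aeval ![y, y'] (truncTotal (D + 1) G) ∈ Ideal.span {(p : Ainf (p := p) F), xi} := fun D =>
    LogTypeSeries.aeval_truncTotal_mem (vecCons_mem' hy hy') hG0 D
  have hgI : g ∈ Ideal.span {(p : Ainf (p := p) F), xi} := by
    have h := hg 0
    rw [zero_add, pow_one] at h
    simpa using add_mem h (hGD 0)
  intro j
  obtain ⟨M₀, h⟩ := hL j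
  obtain ⟨M₀', h'⟩ := hL' j
  refine ⟨max (max M₀ M₀') (2 * (j + k)), fun M hM => ?_⟩
  obtain ⟨a₁, w₁, h1⟩ := h M ((le_max_left _ _).trans ((le_max_left _ _).trans hM))
  obtain ⟨a₂, w₂, h2⟩ := h' M ((le_max_right _ _).trans ((le_max_left _ _).trans hM))
  -- truncation depth `D ≥ M` fine enough for `Λ(j, k)`
  set D : ℕ := M + 2 * (j + k) + 2 with hD
  obtain ⟨a₃, w₃, h3⟩ := logTypePartialSum_aeval_truncTotal_sub_mem_lattice hb hG0 hfG hy hy' (j := j) (k := k) (M := M) (D := D)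
    ((le_max_right _ _).trans hM) (by omega)
  obtain ⟨a₄, w₄, h4⟩ := logTypePartialSum_sub_logTypePartialSum_mem_lattice b hgI (hGD D) (j := j) (k := k) (N := D + 1) (by omega) (hg D) M
  refine ⟨a₁ + a₂ - a₃ - a₄, w₁ + w₂ - w₃ - w₄, ?_⟩
  have e : L + L' - logTypePartialSum b g M = (L - logTypePartialSum b y M) + (L' - logTypePartialSum b y' M) -
      (logTypePartialSum b (MvPolynomial.aeval ![y, y'] (truncTotal (D + 1) G)) M - logTypePartialSum b y M - logTypePartialSum b y' M) -
      (logTypePartialSum b g M - logTypePartialSum b (MvPolynomial.aeval ![y, y'] (truncTotal (D + 1) G)) M) := by ring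
  rw [e]
  exact lattice_sub (lattice_sub (lattice_add h1 h2) h3) h4

end GaloisContinuity

end Literature.NumberTheory.PAdicHodge

end
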